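import Mathlib
import HarnessLib
import Summits.CriticalPhenomena.CardyFormulaZ2.Theses.CardySelfDualSegment
import Literature.Probability.Percolation.CornerPercolation
import Summits.CriticalPhenomena.CardyFormulaZ2.Theorems.CardySelfDualSegmentSegmentOpenIffTarget
import Summits.CriticalPhenomena.CardyFormulaZ2.Theorems.CardySelfDualSegmentSegmentOpenSmirnovGermForm
import Summits.CriticalPhenomena.CardyFormulaZ2.Theorems.CardySelfDualSegmentSegmentOpenCruxIffNoIsolated
import Summits.CriticalPhenomena.CardyFormulaZ2.Theorems.CardySelfDualSegmentSegmentClosed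
import Summits.CriticalPhenomena.CardyFormulaZ2.Theorems.CardySelfDualSegmentSmirnovBasePoint
import Summits.CriticalPhenomena.CardyFormulaZ2.Theorems.CardySelfDualSegmentQuarterTurnPinning

/-!
# Crux `SegmentOpen` (stmt-CriticalPhenomena-5471) — redirect strategist r1: the split
# `SegmentOpen ⇐ NearSmirnov ∧ GermPropagation` (both pieces strictly short of the summit)

Scratch/certification file of `planner-cstrat-stmt-CriticalPhenomena-5471-r1-0` (2026-08-17).

* `NearSmirnov` (child 1, crux): a right-neighbourhood of the Smirnov point is good —
  `∃ ε > 0, ∀ t < ε, t ∈ G`: PERTURBATIVE linear universality of the corner family at the one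
  solved point `t = 0` (site-𝕋).  Strictly short of the summit (says nothing about `t = 1`).
* `GermPropagation` (child 2, crux): `NearSmirnov → SegmentOpen`, i.e. the Smirnov germ plus
  uniform marginality propagate openness of `G` along the whole segment.  Strictly short of the
  summit because it is IMPLIED by the identification-free analyticity statement S4 (uniform
  complex bounds of the crossing polynomials) together with the sibling crux `UniformBoxCrossing`
  (`germPropagation_of_uniformComplexBound`, from the landed p131924
  `segmentOpen_of_segmentClosed_of_smirnovGerm` and the proved `segmentClosed_proof`).
* glue `SegmentOpen_of_subs : NearSmirnov → GermPropagation → SegmentOpen` (modus ponens).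
* records for the tribunal: `segmentOpen_iff_subs` (under UBC, UM the crux is EQUIVALENT to the
  conjunction of the children), `summit_of_segmentOpen` (under UBC, UM the crux gives the summit:
  the crux as filed is summit-strength CONDITIONALLY on the sibling cruxes — `closes` with the four
  proved items discharged), `target_of_segmentOpen'`/`nearSmirnov_of_target`.
-/

noncomputable section

namespace Summit.CriticalPhenomena.CardyFormulaZ2.Theses.CardySelfDualSegment

/-- child 1 (crux) of the r1 split of `SegmentOpen`: NEAR-SMIRNOV LINEAR UNIVERSALITY — there is
`ε > 0` such that every corner model `M_t` with `t < ε` has sheared-Cardy crude crossing limits for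
some modulus `α ∈ ℍ` (route `let`-style, verbatim the parent's blocks). -/
def NearSmirnov : Prop :=
  let prm : unitInterval → Literature.Probability.LatticeModels.Site 2 × Fin 2 → unitInterval := fun t i => if i.2 = 0 then Literature.Probability.Percolation.half else Literature.Probability.Percolation.half * t; let cfg : Set (Literature.Probability.LatticeModels.Site 2 × Fin 2) → Literature.Probability.Percolation.BondConfig (Literature.Probability.LatticeModels.Site 2) := fun S => {e | ∃ v : Literature.Probability.LatticeModels.Site 2, (e = s(v, v + ![1, 0]) ∧ (v, (0 : Fin 2)) ∈ S) ∨ (e = s(v, v + ![0, 1]) ∧ ((v, (0 : Fin 2)) ∈ S ↔ (v, (1 : Fin 2)) ∉ S))}; let P : unitInterval → Literature.Probability.RandomPlanarGeometry.ConformalRectangle → ℝ → ℝ := fun t R δ => (Literature.Probability.LatticeModels.prodBernoulli (prm t)).real {S | cfg S ∈ Literature.Probability.Percolation.embDomainCrossing Literature.Probability.LatticeModels.squareLatticeEmbedding.z R.carrier δ (R.arc 0) (R.arc 2)}; let CardyMod : unitInterval → ℂ → Prop := fun t α => ∀ (R R' : Literature.Probability.RandomPlanarGeometry.ConformalRectangle)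 (φ : Literature.Probability.RandomPlanarGeometry.ConformalEquiv UpperHalfPlane.upperHalfPlaneSet R.carrier) (x : Fin 4 → ℝ), R.carrier = Literature.Barriers.CriticalPhenomena.moduliShear α '' R'.carrier → (∀ i, R.pt i = Literature.Barriers.CriticalPhenomena.moduliShear α (R'.pt i)) → R.IsUniformizing φ x → Filter.Tendsto (P t R') (nhdsWithin 0 (Set.Ioi 0)) (nhds (Literature.Probability.RandomPlanarGeometry.cardyFunction (Literature.Probability.RandomPlanarGeometry.crossRatio x))); let G : Set unitInterval := {t | ∃ α : ℂ, 0 < α.im ∧ CardyMod t α}; ∃ ε > 0, ∀ t : unitInterval, (t : ℝ) < ε → t ∈ G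

/-- child 2 (crux) of the r1 split of `SegmentOpen`: GERM PROPAGATION — if a right-neighbourhood of
the Smirnov point is good, then (under uniform marginality) the good set is open in `[0,1]`
(route `let`-style; literally `NearSmirnov → SegmentOpen` with the bodies inlined). -/
def GermPropagation : Prop :=
  let prm : unitInterval → Literature.Probability.LatticeModels.Site 2 × Fin 2 → unitInterval := fun t i => if i.2 = 0 then Literature.Probability.Percolation.half else Literature.Probability.Percolation.half * t; let cfg : Set (Literature.Probability.LatticeModels.Site 2 × Fin 2) → Literature.Probability.Percolation.BondConfig (Literature.Probability.LatticeModels.Site 2) := fun S => {e | ∃ v : Literature.Probability.LatticeModels.Site 2, (e = s(v, v + ![1, 0]) ∧ (v, (0 : Fin 2)) ∈ S) ∨ (e = s(v, v + ![0, 1]) ∧ ((v, (0 : Fin 2)) ∈ S ↔ (v, (1 : Fin 2)) ∉ S))}; let P : unitInterval → Literature.Probability.RandomPlanarGeometry.ConformalRectangle → ℝ → ℝ := fun t R δ => (Literature.Probability.LatticeModels.prodBernoulli (prm t)).real {S | cfg S ∈ Literature.Probability.Percolation.embDomainCrossing Literature.Probability.LatticeModels.squareLatticeEmbedding.z R.carrier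 δ (R.arc 0) (R.arc 2)}; let CardyMod : unitInterval → ℂ → Prop := fun t α => ∀ (R R' : Literature.Probability.RandomPlanarGeometry.ConformalRectangle) (φ : Literature.Probability.RandomPlanarGeometry.ConformalEquiv UpperHalfPlane.upperHalfPlaneSet R.carrier) (x : Fin 4 → ℝ), R.carrier = Literature.Barriers.CriticalPhenomena.moduliShear α '' R'.carrier → (∀ i, R.pt i = Literature.Barriers.CriticalPhenomena.moduliShear α (R'.pt i)) → R.IsUniformizing φ x → Filter.Tendsto (P t R') (nhdsWithin 0 (Set.Ioi 0)) (nhds (Literature.Probability.RandomPlanarGeometry.cardyFunction (Literature.Probability.RandomPlanarGeometry.crossRatio x))); let G : Set unitInterval := {t | ∃ α : ℂ, 0 < α.im ∧ CardyMod t α}; (∃ ε > 0, ∀ t : unitInterval, (t : ℝ) < ε → t ∈ G) → (∀ (t₀ : unitInterval) (R : Literature.Probability.RandomPlanarGeometry.ConformalRectangle) (ε : ℝ), 0 < ε → ∃ η > 0, ∀ t : unitInterval, dist t t₀ < η → ∀ δ : ℝ, 0 < δ → |P t R δ - P t₀ R δ| < ε) → IsOpen G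

/-- GLUE of the split (modus ponens): `NearSmirnov → GermPropagation → SegmentOpen`. -/
theorem SegmentOpen_of_subs : NearSmirnov → GermPropagation → SegmentOpen := fun h₁ h₂ => h₂ h₁

end Summit.CriticalPhenomena.CardyFormulaZ2.Theses.CardySelfDualSegment

namespace Summit.CriticalPhenomena.CardyFormulaZ2.Cruxes.SegmentOpen.SplitR1

open Filter Set Topology
open Literature.Probability Literature.Barriers.CriticalPhenomena
open Literature.Probability.RandomPlanarGeometry (ConformalRectangle ConformalEquiv)
open Summit.CriticalPhenomena.CardyFormulaZ2.Theses.CardySelfDualSegment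
open Summit.CriticalPhenomena.CardyFormulaZ2.Theorems

/-- `CardyMod t α` of the route over `Percolation.cornerCrossingProb` (= the route's `P`). -/
abbrev CardyModAt (t : unitInterval) (α : ℂ) : Prop :=
  ∀ (R R' : ConformalRectangle)
    (φ : ConformalEquiv UpperHalfPlane.upperHalfPlaneSet R.carrier) (x : Fin 4 → ℝ),
    R.carrier = moduliShear α '' R'.carrier → (∀ i, R.pt i = moduliShear α (R'.pt i)) →
    R.IsUniformizing φ x →
    Tendsto (Percolation.cornerCrossingProb t R') (𝓝[>] 0)
      (𝓝 (RandomPlanarGeometry.cardyFunction (RandomPlanarGeometry.crossRatio x)))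

/-- The route's good set. -/
abbrev goodSet : Set unitInterval := {t | ∃ α : ℂ, 0 < α.im ∧ CardyModAt t α}

/-- The route's `UniformMarginality` body. -/
abbrev UM : Prop :=
  ∀ (t₀ : unitInterval) (R : ConformalRectangle) (ε : ℝ), 0 < ε → ∃ η > 0, ∀ t : unitInterval,
    dist t t₀ < η → ∀ δ : ℝ, 0 < δ →
      |Percolation.cornerCrossingProb t R δ - Percolation.cornerCrossingProb t₀ R δ| < ε

/-- S4 (all conformal rectangles): the uniform-complex-bound hypothesis of p131924, verbatim. -/
abbrev S4 : Prop :=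
  ∀ t₀ : unitInterval, ∃ r > 0, ∀ R : ConformalRectangle, ∃ C : ℝ, ∀ δ : ℝ, 0 < δ →
    ∀ p : Polynomial ℝ,
      (∀ t : unitInterval, Percolation.cornerCrossingProb t R δ = p.eval (t : ℝ)) →
      ∀ z ∈ Metric.ball ((t₀ : ℝ) : ℂ) r, ‖(p.map (algebraMap ℝ ℂ)).eval z‖ ≤ C

theorem nearSmirnov_iff : NearSmirnov ↔ ∃ ε > 0, ∀ t : unitInterval, (t : ℝ) < ε → t ∈ goodSet :=
  Iff.rfl

theorem germPropagation_iff :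
    GermPropagation ↔ ((∃ ε > 0, ∀ t : unitInterval, (t : ℝ) < ε → t ∈ goodSet) → UM → IsOpen goodSet) :=
  Iff.rfl

theorem segmentOpen_iff' : SegmentOpen ↔ (UM → IsOpen goodSet) := Iff.rfl

theorem target_iff' : Target ↔ ∀ t : unitInterval, t ∈ goodSet := Iff.rfl

/-- `NearSmirnov` is a consequence of the route's Target (so it is at most Target-strength; the
probes in `bc/` record that neither it nor the summit implies the other by automation). -/
theorem nearSmirnov_of_target (hT : Target) : NearSmirnov := by
  rw [nearSmirnov_iff]
  exact ⟨1, one_pos, fun t _ => (target_iff'.1 hT) t⟩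

/-- `GermPropagation` is a consequence of the Target (via the landed `segmentOpen_of_target`). -/
theorem germPropagation_of_target (hT : Target) : GermPropagation := by
  rw [germPropagation_iff]
  intro _
  exact (segmentOpen_iff'.1 (segmentOpen_of_target hT))

/-- A right-neighbourhood of `0` in `unitInterval` inside the good set makes `0` an accumulation
point of the good set. -/
theorem accPt_zero_of_nearSmirnov (h : NearSmirnov) : AccPt (0 : unitInterval) (𝓟 goodSet) := by
  rw [nearSmirnov_iff] at h
  obtain ⟨ε, hε, hG⟩ := h
  have hopen : IsOpen {t : unitInterval | (t : ℝ) < ε} :=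
    isOpen_lt continuous_subtype_val continuous_const
  have h0 : (0 : unitInterval) ∈ {t : unitInterval | (t : ℝ) < ε} := by simpa using hε
  have hacc := accPt_principal_of_isOpen_unitInterval hopen h0
  exact hacc.mono (principal_mono.2 fun t ht => hG t ht)

/-- **Child 2 is strictly short of the summit: it is implied by the identification-free analyticity
statement S4 and the sibling crux `UniformBoxCrossing`** (landed p131924
`segmentOpen_of_segmentClosed_of_smirnovGerm`, with `SegmentClosed` discharged by the proved
`segmentClosed_proof`). -/
theorem germPropagation_of_uniformComplexBound (h4 : S4) (hX : UniformBoxCrossing) :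
    GermPropagation := by
  rw [germPropagation_iff]
  intro hnear hUM
  have h0 := accPt_zero_of_nearSmirnov (nearSmirnov_iff.2 hnear)
  exact (segmentOpen_iff'.1
    (segmentOpen_of_segmentClosed_of_smirnovGerm h4 segmentClosed_proof hX h0)) hUM

/-- **Under the sibling cruxes the parent is EQUIVALENT to the conjunction of the children**:
`→` through the Target (`target_of_segmentOpen`, p155692), `←` the glue. -/
theorem segmentOpen_iff_subs (hX : UniformBoxCrossing) (hM : UniformMarginality) :
    SegmentOpen ↔ (NearSmirnov ∧ GermPropagation) :=
  ⟨fun hO => ⟨nearSmirnov_of_target (target_of_segmentOpen hX hM hO),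
      germPropagation_of_target (target_of_segmentOpen hX hM hO)⟩,
    fun h => SegmentOpen_of_subs h.1 h.2⟩

/-- **Summit-strength record (option 3 of the redirect): conditionally on the two sibling cruxes,
the crux as filed gives the summit** — the route's `closes` with its four proved items
(`segmentClosed_proof`, `smirnovBasePoint_proof`, `quarterTurnPinning_proof`,
`CrudeToCanonical_holds`) discharged. -/
theorem summit_of_segmentOpen (hX : UniformBoxCrossing) (hM : UniformMarginality)
    (hO : SegmentOpen) : CardyFormulaZ2 :=
  closes hO hM segmentClosed_proof hX smirnovBasePoint_proof quarterTurnPinning_proof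
    CrudeToCanonical_holds

/-- ... and the Target itself (strictly more than the summit: linear universality at EVERY `t`). -/
theorem target_of_segmentOpen' (hX : UniformBoxCrossing) (hM : UniformMarginality)
    (hO : SegmentOpen) : Target :=
  target_of_segmentOpen hX hM hO

end Summit.CriticalPhenomena.CardyFormulaZ2.Cruxes.SegmentOpen.SplitR1
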